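import Summits.Ventures.Crystal3D.Theorems.StickyWulffConstantCoaxialWallLawTwoLatticeAdm
import HarnessLib

/-!
# Readings in a two-lattice configuration IV: the end multiplicity ON-SITE is the ROOT-CLASS count
# (crux `CoaxialWallLaw`, stmt-Ventures-19481, line `WallLedgerF`; interpretation completeness, part 4)

HONEST FRAMING. Venture `Summits/Ventures/Crystal3D` (cell `crystal3d-full`), helper `--supports` the crux
`CoaxialWallLaw` of `route-Ventures-StickyWulffConstant` (REGISTERED line `WallLedgerF`).  Rung credit; F-C1 not
moved; no census, no kissing facts.  cf-p1 g28 §86(112) DC, bridge (D4) of the on-site/tail reduction (HOME/HANDOFF.md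
«wall-19481-p2 gen 7» addendum): on the census's ON-SITE universe the typed end-pair relation `IsEndPair` of
`…EndRowDefs` — an `∃` over ALL admissible classes of both plate systems — is EQUIVALENT to an explicit finite disjunction
over the ROOT classes (`isEndPair_rootClass_*` of `…TwoLatticeAdm` gives `→`, admissibility of the empty chain gives
`←`), so the typed `endMult` equals a DECIDABLE root-class count that the STEP-3 tables can feed by computation:

* `PlateSystem.adm_root` — `(S.G₀, S.G₀ r)` is admissible for every root `r ∈ S.RT` (empty chain);
* **`isEndPair_iff_root_twinPlates`**, **`endMult_eq_root_twinPlates`** — TWIN plates `(L, H∘L)`, any offsets;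
* **`isEndPair_iff_root_transPlates`**, **`endMult_eq_root_transPlates`** — TRANSLATION plates, deep or basal-fault offset.
WHAT THIS IS NOT: not the β tables, not the tail theorem; F-C1 not moved.
-/

noncomputable section

namespace Summit.Ventures.Crystal3D.Theorems

open Summit.Ventures.Crystal3D Finset
open Literature.MathematicalPhysics.StatisticalMechanics (fccStacking)
open scoped InnerProductSpace

/-- **Root classes are admissible**: `(S.G₀, S.G₀ r)` for `r ∈ S.RT` (the empty chain). -/
theorem PlateSystem.adm_root (S : PlateSystem) {r : EuclideanSpace ℝ (Fin 3)} (hr : r ∈ S.RT) : S.Adm S.G₀ (S.G₀ r) :=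
  ⟨r, hr, [], PlateSystem.wfChain_nil r, rfl, by simp [PlateSystem.Fw]⟩

section TwinPlates

variable (L : EuclideanSpace ℝ (Fin 3) ≃ₗᵢ[ℝ] EuclideanSpace ℝ (Fin 3)) (s₁ s₂ : EuclideanSpace ℝ (Fin 3))
  {X : Finset (EuclideanSpace ℝ (Fin 3))}
  (hX : ∀ x ∈ X, x ∈ (fun p => L p + s₁) '' fccStacking 1 (Real.sqrt (2 / 3)) ∨
    x ∈ (fun p => (((ℝ ∙ EuclideanSpace.single (2 : Fin 3) (1 : ℝ)).reflection).trans L) p + s₂) ''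
      fccStacking 1 (Real.sqrt (2 / 3)))
include hX

/-- **On-site, the twin-plate end-pair relation is the ROOT-CLASS relation.** -/
theorem isEndPair_iff_root_twinPlates (b q : EuclideanSpace ℝ (Fin 3)) :
    IsEndPair X WordVersion.v1 ⟨L, inPlaneRoots L 1⟩
        ⟨((ℝ ∙ EuclideanSpace.single (2 : Fin 3) (1 : ℝ)).reflection).trans L,
          inPlaneRoots (((ℝ ∙ EuclideanSpace.single (2 : Fin 3) (1 : ℝ)).reflection).trans L) (-1)⟩ b q ↔
      q ∈ X ∧ b ∈ X ∧ HasTwoPayers X b ∧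
        ((∃ r ∈ inPlaneRoots L 1, IsEndMove X WordVersion.v1 L (L r) q b) ∨
          (∃ r ∈ inPlaneRoots (((ℝ ∙ EuclideanSpace.single (2 : Fin 3) (1 : ℝ)).reflection).trans L) (-1),
            IsEndMove X WordVersion.v1 (((ℝ ∙ EuclideanSpace.single (2 : Fin 3) (1 : ℝ)).reflection).trans L)
              ((((ℝ ∙ EuclideanSpace.single (2 : Fin 3) (1 : ℝ)).reflection).trans L) r) q b)) := by
  constructor
  · intro h
    refine ⟨h.1, h.2.1, h.2.2.1, ?_⟩
    obtain ⟨G, d, hGd, hmove⟩ := isEndPair_rootClass_twinPlates L s₁ s₂ hX h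
    rcases hGd with ⟨hG, r, hr, hd⟩ | ⟨hG, r, hr, hd⟩
    · rw [hG, hd] at hmove; exact Or.inl ⟨r, hr, hmove⟩
    · rw [hG, hd] at hmove; exact Or.inr ⟨r, hr, hmove⟩
  · rintro ⟨hq, hb, hpay, hroot⟩
    refine ⟨hq, hb, hpay, ?_⟩
    rcases hroot with ⟨r, hr, hmove⟩ | ⟨r, hr, hmove⟩
    · exact ⟨L, L r, Or.inl (PlateSystem.adm_root ⟨L, inPlaneRoots L 1⟩ hr), hmove⟩
    · exact ⟨_, _, Or.inr (PlateSystem.adm_root ⟨((ℝ ∙ EuclideanSpace.single (2 : Fin 3) (1 : ℝ)).reflection).trans L,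
        inPlaneRoots (((ℝ ∙ EuclideanSpace.single (2 : Fin 3) (1 : ℝ)).reflection).trans L) (-1)⟩ hr), hmove⟩

open scoped Classical in
/-- **On-site, the twin-plate end multiplicity is the root-class count.** -/
theorem endMult_eq_root_twinPlates (b : EuclideanSpace ℝ (Fin 3)) :
    endMult X WordVersion.v1 ⟨L, inPlaneRoots L 1⟩
        ⟨((ℝ ∙ EuclideanSpace.single (2 : Fin 3) (1 : ℝ)).reflection).trans L,
          inPlaneRoots (((ℝ ∙ EuclideanSpace.single (2 : Fin 3) (1 : ℝ)).reflection).trans L) (-1)⟩ b =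
      (X.filter fun q => b ∈ X ∧ HasTwoPayers X b ∧
        ((∃ r ∈ inPlaneRoots L 1, IsEndMove X WordVersion.v1 L (L r) q b) ∨
          (∃ r ∈ inPlaneRoots (((ℝ ∙ EuclideanSpace.single (2 : Fin 3) (1 : ℝ)).reflection).trans L) (-1),
            IsEndMove X WordVersion.v1 (((ℝ ∙ EuclideanSpace.single (2 : Fin 3) (1 : ℝ)).reflection).trans L)
              ((((ℝ ∙ EuclideanSpace.single (2 : Fin 3) (1 : ℝ)).reflection).trans L) r) q b))).card := by
  unfold endMult
  congr 1
  refine Finset.filter_congr fun q hq => ?_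
  rw [isEndPair_iff_root_twinPlates L s₁ s₂ hX b q]
  exact ⟨fun h => h.2, fun h => ⟨hq, h⟩⟩

end TwinPlates

section TransPlates

variable (L : EuclideanSpace ℝ (Fin 3) ≃ₗᵢ[ℝ] EuclideanSpace ℝ (Fin 3)) (s₁ s₂ : EuclideanSpace ℝ (Fin 3))
  {X : Finset (EuclideanSpace ℝ (Fin 3))}
  (hX : ∀ x ∈ X, x ∈ (fun p => L p + s₁) '' fccStacking 1 (Real.sqrt (2 / 3)) ∨
    x ∈ (fun p => L p + s₂) '' fccStacking 1 (Real.sqrt (2 / 3)))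
  (hoff : L.symm ((3 : ℝ) • (s₂ - s₁)) ∉ fccStacking 1 (Real.sqrt (2 / 3)) ∨
    ((∃ a' : ℤ, L.symm (s₂ - s₁ - (a' : ℝ) • (Real.sqrt (2 / 3) • L (EuclideanSpace.single (2 : Fin 3) (1 : ℝ)))) ∈
      fccStacking 1 (Real.sqrt (2 / 3))) ∧ L.symm (s₂ - s₁) ∉ fccStacking 1 (Real.sqrt (2 / 3))))
include hX hoff

/-- **On-site (deep or basal-fault offset), the translation-plate end-pair relation is the ROOT-CLASS relation.** -/
theorem isEndPair_iff_root_transPlates (b q : EuclideanSpace ℝ (Fin 3)) :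
    IsEndPair X WordVersion.v1 ⟨L, inPlaneRoots L 1⟩ ⟨L, inPlaneRoots L (-1)⟩ b q ↔
      q ∈ X ∧ b ∈ X ∧ HasTwoPayers X b ∧
        ∃ r ∈ inPlaneRoots L 1 ∪ inPlaneRoots L (-1), IsEndMove X WordVersion.v1 L (L r) q b := by
  constructor
  · intro h
    obtain ⟨d, ⟨r, hr, hd⟩, hmove⟩ := isEndPair_rootClass_transPlates L s₁ s₂ hX hoff h
    rw [hd] at hmove
    exact ⟨h.1, h.2.1, h.2.2.1, r, hr, hmove⟩
  · rintro ⟨hq, hb, hpay, r, hr, hmove⟩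
    refine ⟨hq, hb, hpay, L, L r, ?_, hmove⟩
    rcases Finset.mem_union.1 hr with hr | hr
    · exact Or.inl (PlateSystem.adm_root ⟨L, inPlaneRoots L 1⟩ hr)
    · exact Or.inr (PlateSystem.adm_root ⟨L, inPlaneRoots L (-1)⟩ hr)

open scoped Classical in
/-- **On-site (deep or basal-fault offset), the translation-plate end multiplicity is the root-class count.** -/
theorem endMult_eq_root_transPlates (b : EuclideanSpace ℝ (Fin 3)) :
    endMult X WordVersion.v1 ⟨L, inPlaneRoots L 1⟩ ⟨L, inPlaneRoots L (-1)⟩ b =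
      (X.filter fun q => b ∈ X ∧ HasTwoPayers X b ∧
        ∃ r ∈ inPlaneRoots L 1 ∪ inPlaneRoots L (-1), IsEndMove X WordVersion.v1 L (L r) q b).card := by
  unfold endMult
  congr 1
  refine Finset.filter_congr fun q hq => ?_
  rw [isEndPair_iff_root_transPlates L s₁ s₂ hX hoff b q]
  exact ⟨fun h => h.2, fun h => ⟨hq, h⟩⟩

end TransPlates

end Summit.Ventures.Crystal3D.Theorems

end
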